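import Mathlib.GroupTheory.SpecificGroups.Cyclic
import Literature.IUT.HodgeTheaters.PuncturedEllipticCoverings
import Literature.IUT.HodgeTheaters.PuncturedEllipticCoveringsBasic
import HarnessLib

/-!
# [IUTchI] Corollary 1.2: the group-theoretic core — proof-only companion of `PuncturedEllipticCoverings`

Mochizuki, *Inter-universal Teichmüller theory I*, kurims manuscript (May 2020), §1, Corollary 1.2
"Characteristic Nature of Coverings", p. 39, with the proof on p. 39 and Remark 1.2.1 (p. 40)
([IUTchI] Cor 1.2 p.39) [claim: Mochizuki2012, status: disputed].  Node `IUTchI:Cor1.2` of the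
cell's DAG; statement = `PuncturedEllipticData.CharacteristicNatureOfCoverings` (seat abc-iut-L5-t1).

WHAT IS PROVED HERE (pure profinite group theory over the standing data `PuncturedEllipticData`;
no anabelian input is asserted or restated).  The printed proof reconstructs `Π_C̲ ⊇ Π_X̲ ⊇ Π_{X→}`
and `Π_{C→}` from `Π_{X→}` in two moves: (a) an ANABELIAN move — `C` is a `k`-core, so an
isomorphism `Π_{X→} ⥲ Π'_{X→}` extends to the cores, and the decomposition groups of cusps are
group-theoretic ([AbsTopI] Lem. 4.5, [AbsAnab] Lem. 1.3.9 as amended by Rmk. 1.2.2) — these are the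
prerequisite layer's facts (seat abc-iut-L4-t4) and enter below ONLY as explicit hypotheses of
implication theorems; (b) a GROUP-THEORETIC move — once an isomorphism `Φ : Π_C̲ ⥲ Π'_C̲` with
`Φ(Π_{X→}) = Π'_{X→}` is in hand, the intermediate coverings are pinned down by the printed facts
`Gal(X→/C̲) ≅ ℤ/2lℤ`, `Gal(X̲/C̲) ≅ ℤ/2ℤ`, `Gal(C→/C̲) ≅ ℤ/lℤ` (p. 38; Rmk. 1.2.1 p. 40): a finite
cyclic group has at most one subgroup of any given index, so `Φ(Π_X̲) = Π'_X̲` and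
`Φ(Π_{C→}) = Π'_{C→}`.  Move (b) is discharged here, GIVEN the printed claims of pp. 37–38 about the
construction (`ArrowCoveringClaims`, the predicate of the statement file) for both data:

* `ArrowCoveringClaims.relIndex_piXbar` — `[Π_C̲ : Π_X̲] = 2` (from `[Π_C : Π_X] = 2`, the
  cartesian square and the indices `l ≠ 2l`);
* `ArrowCoveringClaims.map_subgroupOf_piXbar_eq`, `ArrowCoveringClaims.map_subgroupOf_piCarrow_eq`
  — move (b) for ANY `Φ : Π_C̲ ≃* Π'_C̲` with `Φ(Π_{X→}) = Π'_{X→}`;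
* `Rmk121.map_piCbar_eq` — Remark 1.2.1's normaliser description `Π_C̲ = N_{Π_C}(Π_{X→})`
  transports: any `Θ : Π_C ≃* Π'_C` with `Θ(Π_{X→}) = Π'_{X→}` carries `Π_C̲` onto `Π'_C̲`
  (and then `Π_X̲`, `Π_{C→}` onto their counterparts: `Rmk121.map_piXbar_eq`, `Rmk121.map_piCarrow_eq`);
* `characteristicNatureOfCoverings_of_core_extensions` — the typed Corollary 1.2 for `(D, D')`
  follows from `ArrowCoveringClaims D`, `ArrowCoveringClaims D'` and the two anabelian inputs (a),
  stated as hypotheses in exactly the shape the printed proof uses them (extension of the given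
  isomorphism to `Π_C̲` respecting the cusp classes).

Helper (folklore, used on p. 39 through "`≅ ℤ/2lℤ`"): `Subgroup.eq_of_card_eq_of_isCyclic`,
`Subgroup.eq_of_index_eq_of_isCyclic_quotient`.  No new definitions; nothing is asserted about the
anabelian inputs; no side is taken on [IUTchIII] Cor. 3.12; typed ≠ discharged for move (a).
-/

namespace Literature.IUT.HodgeTheaters

open Literature.AnabelianGeometry.AbsoluteAnabelian

universe u

/-! ### Folklore: a finite cyclic group has at most one subgroup of each order / index -/

section Cyclic

variable {Z : Type*} [Group Z]

/-- In a finite cyclic group a subgroup `H` is the set of solutions of `a ^ |H| = 1` (there are at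
most `|H|` of them, Mathlib `IsCyclic.card_pow_eq_one_le`, and `H` supplies `|H|`); used on p. 39
through "`Gal(X→/C̲) ≅ ℤ/2lℤ`". [cite: Mochizuki2012, Cor 1.2 p.39] -/
theorem Subgroup.mem_iff_pow_card_eq_one_of_isCyclic [Finite Z] [IsCyclic Z] (H : Subgroup Z)
    (x : Z) : x ∈ H ↔ x ^ Nat.card H = 1 := by
  classical
  constructor
  · intro hx
    have h := pow_card_eq_one' (G := H) (x := ⟨x, hx⟩)
    rw [Subtype.ext_iff, Subgroup.coe_pow, Subgroup.coe_one] at h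
    exact h
  · intro hx
    let _ : Fintype Z := Fintype.ofFinite Z
    set F : Finset Z := Finset.univ.filter fun a : Z => a ^ Nat.card H = 1 with hFdef
    set S : Finset Z := Finset.univ.filter fun a : Z => a ∈ H with hSdef
    have hpos : 0 < Nat.card H := Nat.card_pos
    have hF : F.card ≤ Nat.card H := by
      rw [hFdef]
      convert IsCyclic.card_pow_eq_one_le (α := Z) hpos using 2
    have hS : S.card = Nat.card H := by
      rw [hSdef, Nat.card_eq_fintype_card, ← Fintype.card_subtype]
    have hSF : S ⊆ F := by
      intro a ha
      rw [hSdef, Finset.mem_filter] at ha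
      rw [hFdef, Finset.mem_filter]
      refine ⟨Finset.mem_univ _, ?_⟩
      have h := pow_card_eq_one' (G := H) (x := ⟨a, ha.2⟩)
      rw [Subtype.ext_iff, Subgroup.coe_pow, Subgroup.coe_one] at h
      exact h
    have hEq : S = F := Finset.eq_of_subset_of_card_le hSF (by rw [hS]; exact hF)
    have hxF : x ∈ F := by
      rw [hFdef, Finset.mem_filter]
      exact ⟨Finset.mem_univ _, hx⟩
    rw [← hEq, hSdef, Finset.mem_filter] at hxF
    exact hxF.2

/-- A finite cyclic group has at most one subgroup of each order. [cite: Mochizuki2012, Cor 1.2 p.39] -/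
theorem Subgroup.eq_of_card_eq_of_isCyclic [Finite Z] [IsCyclic Z] {H K : Subgroup Z}
    (h : Nat.card H = Nat.card K) : H = K := by
  ext x
  rw [Subgroup.mem_iff_pow_card_eq_one_of_isCyclic H, Subgroup.mem_iff_pow_card_eq_one_of_isCyclic K,
    h]

/-- Over a normal subgroup `N` with FINITE CYCLIC quotient, an intermediate subgroup is determined
by its index: if `N ≤ H`, `N ≤ K` and `[Q : H] = [Q : K]` then `H = K`.  (This is how p. 39 pins
down `Π_X̲` and `Π_{C→}` between `Π_{X→}` and `Π_C̲`.) [cite: Mochizuki2012, Cor 1.2 p.39] -/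
theorem Subgroup.eq_of_index_eq_of_isCyclic_quotient {Q : Type*} [Group Q] (N : Subgroup Q)
    [N.Normal] [IsCyclic (Q ⧸ N)] (hN : N.index ≠ 0) {H K : Subgroup Q} (hNH : N ≤ H)
    (hNK : N ≤ K) (h : H.index = K.index) : H = K := by
  haveI : Finite (Q ⧸ N) := Subgroup.index_ne_zero_iff_finite.mp hN
  have hkerH : (QuotientGroup.mk' N).ker ≤ H := by rw [QuotientGroup.ker_mk']; exact hNH
  have hkerK : (QuotientGroup.mk' N).ker ≤ K := by rw [QuotientGroup.ker_mk']; exact hNK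
  have hH : (H.map (QuotientGroup.mk' N)).index = H.index :=
    Subgroup.index_map_eq _ (QuotientGroup.mk'_surjective N) hkerH
  have hK : (K.map (QuotientGroup.mk' N)).index = K.index :=
    Subgroup.index_map_eq _ (QuotientGroup.mk'_surjective N) hkerK
  have hHi : H.index ≠ 0 := fun h0 =>
    hN (Nat.eq_zero_of_zero_dvd (h0 ▸ Subgroup.index_dvd_of_le hNH))
  have hcard : Nat.card (H.map (QuotientGroup.mk' N)) = Nat.card (K.map (QuotientGroup.mk' N)) := by
    have h1 := (H.map (QuotientGroup.mk' N)).card_mul_index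
    have h2 := (K.map (QuotientGroup.mk' N)).card_mul_index
    rw [hH] at h1
    rw [hK, ← h] at h2
    exact Nat.eq_of_mul_eq_mul_right (Nat.pos_of_ne_zero hHi) (h1.trans h2.symm)
  have hmap : H.map (QuotientGroup.mk' N) = K.map (QuotientGroup.mk' N) :=
    Subgroup.eq_of_card_eq_of_isCyclic hcard
  calc H = (H.map (QuotientGroup.mk' N)).comap (QuotientGroup.mk' N) :=
        (Subgroup.comap_map_eq_self hkerH).symm
    _ = (K.map (QuotientGroup.mk' N)).comap (QuotientGroup.mk' N) := by rw [hmap]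
    _ = K := Subgroup.comap_map_eq_self hkerK

/-- Transport of "`A` inside `C`" along a restricted isomorphism: if `Φ : C ≃* C'` is the
restriction of `Θ : G ≃* G'`, then `Φ(A ∩ C) = Θ(A) ∩ C'` for `A ≤ C`. [cite: Mochizuki2012, Cor 1.2 p.39] -/
theorem Subgroup.map_subgroupOf_eq_of_restrict {G G' : Type*} [Group G] [Group G']
    (Θ : G ≃* G') {C : Subgroup G} {C' : Subgroup G'} (Φ : C ≃* C')
    (hΦ : ∀ x : C, ((Φ x : C') : G') = Θ (x : G)) {A : Subgroup G} (hA : A ≤ C) :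
    (A.subgroupOf C).map Φ.toMonoidHom = (A.map Θ.toMonoidHom).subgroupOf C' := by
  ext y
  simp only [Subgroup.mem_map, Subgroup.mem_subgroupOf, MulEquiv.coe_toMonoidHom]
  constructor
  · rintro ⟨x, hx, rfl⟩
    exact ⟨(x : G), hx, (hΦ x).symm⟩
  · rintro ⟨a, ha, hay⟩
    refine ⟨⟨a, hA ha⟩, ha, ?_⟩
    apply Subtype.ext
    rw [hΦ]
    exact hay

end Cyclic

/-! ### The group-theoretic move of the proof of Corollary 1.2 (p. 39) -/

namespace PuncturedEllipticData

variable {D D' : PuncturedEllipticData.{u}}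

/-- `Π_{X→} ⊆ Π_X̲` read off the printed cartesian square `Π_{X→} = Π_X̲ ∩ Π_{C→}`.
([IUTchI] §1 p.38) [claim: Mochizuki2012, status: disputed] -/
theorem ArrowCoveringClaims.piXarrow_eq_inf (h : D.ArrowCoveringClaims) :
    D.piXarrow = D.PiXbar ⊓ D.piCarrow := h.cartesian

/-- `[Π_C̲ : Π_X̲] = 2`, i.e. `Gal(X̲/C̲) ≅ ℤ/2ℤ` (p. 38): `[Π_C : Π_X] = 2` gives `≤ 2`, and
`Π_X̲ = Π_C̲` is excluded since then the cartesian square would force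
`[Π_C̲ : Π_{X→}] = [Π_C̲ : Π_{C→}]`, i.e. `2l = l`. ([IUTchI] §1 p.38) [claim: Mochizuki2012, status: disputed] -/
theorem ArrowCoveringClaims.relIndex_piXbar (h : D.ArrowCoveringClaims) :
    D.PiXbar.relIndex D.PiCbar = 2 := by
  have hB : D.PiXbar.relIndex D.PiCbar = D.PiX.relIndex D.PiCbar := by
    show (D.PiX ⊓ D.PiCbar).relIndex D.PiCbar = _
    exact Subgroup.inf_relIndex_right _ _
  have h2 : D.PiX.index = 2 := D.index_piX
  have hneTop : D.PiX.relIndex ⊤ ≠ 0 := by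
    rw [Subgroup.relIndex_top_right, h2]; decide
  have hle : D.PiX.relIndex D.PiCbar ≤ 2 := by
    have hle' := Subgroup.relIndex_le_of_le_right (H := D.PiX) (le_top : D.PiCbar ≤ ⊤) hneTop
    rwa [Subgroup.relIndex_top_right, h2] at hle'
  have hne0 : D.PiX.relIndex D.PiCbar ≠ 0 := fun h0 =>
    hneTop (Subgroup.relIndex_eq_zero_of_le_right le_top h0)
  have hne1 : D.PiX.relIndex D.PiCbar ≠ 1 := by
    intro h1
    have hle1 : D.PiCbar ≤ D.PiX := Subgroup.relIndex_eq_one.mp h1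
    have hCbB : D.PiCbar ≤ D.PiXbar := le_inf hle1 le_rfl
    have hBCb : D.PiXbar ⊓ D.PiCbar = D.PiCbar := inf_eq_right.mpr hCbB
    have hB1 : D.PiXbar.relIndex D.PiCbar = 1 := Subgroup.relIndex_eq_one.mpr hCbB
    have key := Subgroup.relIndex_inf_mul_relIndex D.piCarrow D.PiXbar D.PiCbar
    rw [hBCb, hB1, mul_one, inf_comm, ← h.cartesian, h.piXarrow_relindex,
      h.piCarrow_relindex] at key
    have h5 := D.five_le
    omega
  rw [hB]
  omega

/-- `Π_{X→}` has finite index `2l ≠ 0` in `Π_C̲`. ([IUTchI] §1 p.38) [claim: Mochizuki2012, status: disputed] -/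
theorem ArrowCoveringClaims.index_subgroupOf_piXarrow_ne_zero (h : D.ArrowCoveringClaims) :
    (D.piXarrow.subgroupOf D.PiCbar).index ≠ 0 := by
  show D.piXarrow.relIndex D.PiCbar ≠ 0
  rw [h.piXarrow_relindex]
  have h5 := D.five_le
  omega

/-- **Corollary 1.2, group-theoretic core, `Π_X̲`** (p. 39): for data `D`, `D'` satisfying the
printed claims of pp. 37–38, ANY isomorphism `Φ : Π_C̲ ⥲ Π'_C̲` carrying `Π_{X→}` onto `Π'_{X→}`
carries `Π_X̲` onto `Π'_X̲` — both are the unique index-`2` subgroup of `Π_C̲ ⊇ Π_{X→}` over the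
cyclic quotient `Gal(X→/C̲) ≅ ℤ/2lℤ`. ([IUTchI] Cor 1.2 p.39) [claim: Mochizuki2012, status: disputed] -/
theorem ArrowCoveringClaims.map_subgroupOf_piXbar_eq (h : D.ArrowCoveringClaims)
    (h' : D'.ArrowCoveringClaims) (Φ : D.PiCbar ≃* D'.PiCbar)
    (hΦ : (D.piXarrow.subgroupOf D.PiCbar).map Φ.toMonoidHom = D'.piXarrow.subgroupOf D'.PiCbar) :
    (D.PiXbar.subgroupOf D.PiCbar).map Φ.toMonoidHom = D'.PiXbar.subgroupOf D'.PiCbar := by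
  haveI : (D'.piXarrow.subgroupOf D'.PiCbar).Normal := h'.piXarrow_normal
  haveI : IsCyclic (D'.PiCbar ⧸ D'.piXarrow.subgroupOf D'.PiCbar) := h'.galX_cyclic
  refine Subgroup.eq_of_index_eq_of_isCyclic_quotient (D'.piXarrow.subgroupOf D'.PiCbar)
    h'.index_subgroupOf_piXarrow_ne_zero ?_ ?_ ?_
  · rw [← hΦ]
    exact Subgroup.map_mono (Subgroup.comap_mono D.piXarrow_le_piXbar)
  · exact Subgroup.comap_mono D'.piXarrow_le_piXbar
  · rw [Subgroup.index_map_of_bijective (f := Φ.toMonoidHom) Φ.bijective]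
    show D.PiXbar.relIndex D.PiCbar = D'.PiXbar.relIndex D'.PiCbar
    rw [h.relIndex_piXbar, h'.relIndex_piXbar]

/-- **Corollary 1.2, group-theoretic core, `Π_{C→}`** (p. 39): for data `D`, `D'` satisfying the
printed claims of pp. 37–38, ANY isomorphism `Φ : Π_C̲ ⥲ Π'_C̲` carrying `Π_{X→}` onto `Π'_{X→}`
carries `Π_{C→}` onto `Π'_{C→}` — both are the unique index-`l` subgroup of `Π_C̲ ⊇ Π_{X→}` over the
cyclic quotient `Gal(X→/C̲) ≅ ℤ/2lℤ`. ([IUTchI] Cor 1.2 p.39) [claim: Mochizuki2012, status: disputed] -/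
theorem ArrowCoveringClaims.map_subgroupOf_piCarrow_eq (h : D.ArrowCoveringClaims)
    (h' : D'.ArrowCoveringClaims) (Φ : D.PiCbar ≃* D'.PiCbar)
    (hΦ : (D.piXarrow.subgroupOf D.PiCbar).map Φ.toMonoidHom = D'.piXarrow.subgroupOf D'.PiCbar)
    (hl : D.l = D'.l) :
    (D.piCarrow.subgroupOf D.PiCbar).map Φ.toMonoidHom = D'.piCarrow.subgroupOf D'.PiCbar := by
  haveI : (D'.piXarrow.subgroupOf D'.PiCbar).Normal := h'.piXarrow_normal
  haveI : IsCyclic (D'.PiCbar ⧸ D'.piXarrow.subgroupOf D'.PiCbar) := h'.galX_cyclic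
  refine Subgroup.eq_of_index_eq_of_isCyclic_quotient (D'.piXarrow.subgroupOf D'.PiCbar)
    h'.index_subgroupOf_piXarrow_ne_zero ?_ ?_ ?_
  · rw [← hΦ]
    exact Subgroup.map_mono (Subgroup.comap_mono D.piXarrow_le_piCarrow)
  · exact Subgroup.comap_mono D'.piXarrow_le_piCarrow
  · rw [Subgroup.index_map_of_bijective (f := Φ.toMonoidHom) Φ.bijective]
    show D.piCarrow.relIndex D.PiCbar = D'.piCarrow.relIndex D'.PiCbar
    rw [h.piCarrow_relindex, h'.piCarrow_relindex, hl]

/-- The integer `l` is recovered from `Π_{X→} ⊆ Π_C̲` as half the index: an isomorphism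
`Φ : Π_C̲ ⥲ Π'_C̲` with `Φ(Π_{X→}) = Π'_{X→}` forces `l = l'` (p. 38: `Gal(X→/C̲) ≅ ℤ/2lℤ`).
([IUTchI] Cor 1.2 p.39) [claim: Mochizuki2012, status: disputed] -/
theorem ArrowCoveringClaims.l_eq_of_map_subgroupOf_piXarrow_eq (h : D.ArrowCoveringClaims)
    (h' : D'.ArrowCoveringClaims) (Φ : D.PiCbar ≃* D'.PiCbar)
    (hΦ : (D.piXarrow.subgroupOf D.PiCbar).map Φ.toMonoidHom = D'.piXarrow.subgroupOf D'.PiCbar) :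
    D.l = D'.l := by
  have hi := Subgroup.index_map_of_bijective (f := Φ.toMonoidHom) Φ.bijective
    (D.piXarrow.subgroupOf D.PiCbar)
  rw [hΦ] at hi
  have hi' : D'.piXarrow.relIndex D'.PiCbar = D.piXarrow.relIndex D.PiCbar := hi
  rw [h.piXarrow_relindex, h'.piXarrow_relindex] at hi'
  omega

/-! ### Remark 1.2.1: the half that follows from pp. 37–38 -/

/-- Half of **Remark 1.2.1** (p. 40) from the claims of pp. 37–38: `Π_C̲` normalises `Π_{X→}`
[`Gal(X→/C̲) ⊆ Aut_k(X→)`], i.e. `Π_C̲ ≤ N_{Π_C}(Π_{X→})`. ([IUTchI] Rmk 1.2.1 p.40) [claim: Mochizuki2012, status: disputed] -/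
theorem ArrowCoveringClaims.piCbar_le_normalizer_piXarrow (h : D.ArrowCoveringClaims) :
    D.PiCbar ≤ Subgroup.normalizer (D.piXarrow : Set D.PiC) :=
  haveI := h.piXarrow_normal
  Subgroup.le_normalizer_of_normal_subgroupOf D.piXarrow_le_piCbar

/-- Half of **Remark 1.2.1** (p. 40) from the claims of pp. 37–38: `Π_C̲` normalises `Π_{C→}`
[`Gal(C→/C̲) ⊆ Aut_k(C→)`], i.e. `Π_C̲ ≤ N_{Π_C}(Π_{C→})`. ([IUTchI] Rmk 1.2.1 p.40) [claim: Mochizuki2012, status: disputed] -/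
theorem ArrowCoveringClaims.piCbar_le_normalizer_piCarrow (h : D.ArrowCoveringClaims) :
    D.PiCbar ≤ Subgroup.normalizer (D.piCarrow : Set D.PiC) :=
  haveI := h.piCarrow_normal
  Subgroup.le_normalizer_of_normal_subgroupOf D.piCarrow_le_piCbar

/-- **Remark 1.2.1 reduced to its geometric half.**  Given the claims of pp. 37–38, Remark 1.2.1
(`Aut_k(X→) = Gal(X→/C̲) ≅ ℤ/2lℤ`, `Aut_k(C→) = Gal(C→/C̲) ≅ ℤ/lℤ`, rendered as normaliser
equalities) follows from the two inclusions `N_{Π_C}(Π_{X→}) ≤ Π_C̲`, `N_{Π_C}(Π_{C→}) ≤ Π_C̲` — the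
part that uses "`C` is a `k`-core" (hypotheses here, not asserted). ([IUTchI] Rmk 1.2.1 p.40)
[claim: Mochizuki2012, status: disputed] -/
theorem ArrowCoveringClaims.rmk121_of_normalizer_le (h : D.ArrowCoveringClaims)
    (hX : Subgroup.normalizer (D.piXarrow : Set D.PiC) ≤ D.PiCbar)
    (hC : Subgroup.normalizer (D.piCarrow : Set D.PiC) ≤ D.PiCbar) : D.Rmk121 :=
  ⟨le_antisymm hX h.piCbar_le_normalizer_piXarrow, le_antisymm hC h.piCbar_le_normalizer_piCarrow,
    h.piXarrow_relindex, h.piCarrow_relindex⟩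

/-! ### Remark 1.2.1 transports: extensions from the core `Π_C` -/

/-- **Remark 1.2.1 ⇒ `Π_C̲` is characteristic for `Π_{X→} ⊆ Π_C`**: if the normaliser description
`N_{Π_C}(Π_{X→}) = Π_C̲` holds for `D` and `D'`, then any isomorphism `Θ : Π_C ⥲ Π'_C` with
`Θ(Π_{X→}) = Π'_{X→}` satisfies `Θ(Π_C̲) = Π'_C̲`. ([IUTchI] Rmk 1.2.1 p.40) [claim: Mochizuki2012, status: disputed] -/
theorem Rmk121.map_piCbar_eq (h : D.Rmk121) (h' : D'.Rmk121) (Θ : D.PiC ≃* D'.PiC)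
    (hΘ : D.piXarrow.map Θ.toMonoidHom = D'.piXarrow) :
    D.PiCbar.map Θ.toMonoidHom = D'.PiCbar := by
  rw [← h.normalizer_piXarrow, ← h'.normalizer_piXarrow, Subgroup.map_equiv_normalizer_eq, hΘ]

/-- The restriction `Π_C̲ ⥲ Π'_C̲` of an isomorphism `Θ : Π_C ⥲ Π'_C` with `Θ(Π_C̲) = Π'_C̲` (as an
existence statement, to keep this companion definition-free). ([IUTchI] Cor 1.2 p.39) [claim: Mochizuki2012, status: disputed] -/
theorem exists_restrict_piCbar (Θ : D.PiC ≃* D'.PiC)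
    (hΘ : D.PiCbar.map Θ.toMonoidHom = D'.PiCbar) :
    ∃ Φ : D.PiCbar ≃* D'.PiCbar, ∀ x : D.PiCbar, ((Φ x : D'.PiCbar) : D'.PiC) = Θ (x : D.PiC) :=
  ⟨(Θ.subgroupMap D.PiCbar).trans (MulEquiv.subgroupCongr (by
    rw [← hΘ, MulEquiv.toMonoidHom_eq_coe])), fun _ => rfl⟩

/-- Under `Θ(Π_{X→}) = Π'_{X→}`, a restriction `Φ` of `Θ` to `Π_C̲ ⥲ Π'_C̲` carries
`Π_{X→} ⊆ Π_C̲` onto `Π'_{X→} ⊆ Π'_C̲`. ([IUTchI] Cor 1.2 p.39) [claim: Mochizuki2012, status: disputed] -/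
theorem map_subgroupOf_piXarrow_of_restrict (Θ : D.PiC ≃* D'.PiC) (Φ : D.PiCbar ≃* D'.PiCbar)
    (hΦ : ∀ x : D.PiCbar, ((Φ x : D'.PiCbar) : D'.PiC) = Θ (x : D.PiC))
    (hΘX : D.piXarrow.map Θ.toMonoidHom = D'.piXarrow) :
    (D.piXarrow.subgroupOf D.PiCbar).map Φ.toMonoidHom = D'.piXarrow.subgroupOf D'.PiCbar := by
  rw [Subgroup.map_subgroupOf_eq_of_restrict Θ Φ hΦ D.piXarrow_le_piCbar, hΘX]

/-- **Remark 1.2.1 + Corollary 1.2 core, `Π_X̲` at the level of `Π_C`**: for data satisfying the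
printed claims of pp. 37–38 and Remark 1.2.1, any `Θ : Π_C ⥲ Π'_C` with `Θ(Π_{X→}) = Π'_{X→}`
carries `Π_X̲` onto `Π'_X̲`. ([IUTchI] Cor 1.2 p.39) [claim: Mochizuki2012, status: disputed] -/
theorem Rmk121.map_piXbar_eq (hR : D.Rmk121) (hR' : D'.Rmk121) (h : D.ArrowCoveringClaims)
    (h' : D'.ArrowCoveringClaims) (Θ : D.PiC ≃* D'.PiC)
    (hΘ : D.piXarrow.map Θ.toMonoidHom = D'.piXarrow) :
    D.PiXbar.map Θ.toMonoidHom = D'.PiXbar := by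
  have hC := hR.map_piCbar_eq hR' Θ hΘ
  obtain ⟨Φ, hΦ⟩ := exists_restrict_piCbar Θ hC
  have key := h.map_subgroupOf_piXbar_eq h' Φ (map_subgroupOf_piXarrow_of_restrict Θ Φ hΦ hΘ)
  rw [Subgroup.map_subgroupOf_eq_of_restrict Θ Φ hΦ D.piXbar_le_piCbar, Subgroup.subgroupOf_inj,
    inf_eq_left.mpr D'.piXbar_le_piCbar] at key
  rw [← key, eq_comm, inf_eq_left, ← hC]
  exact Subgroup.map_mono D.piXbar_le_piCbar

/-- **Remark 1.2.1 + Corollary 1.2 core, `Π_{C→}` at the level of `Π_C`**: for data satisfying the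
printed claims of pp. 37–38 and Remark 1.2.1, any `Θ : Π_C ⥲ Π'_C` with `Θ(Π_{X→}) = Π'_{X→}`
carries `Π_{C→}` onto `Π'_{C→}`. ([IUTchI] Cor 1.2 p.39) [claim: Mochizuki2012, status: disputed] -/
theorem Rmk121.map_piCarrow_eq (hR : D.Rmk121) (hR' : D'.Rmk121) (h : D.ArrowCoveringClaims)
    (h' : D'.ArrowCoveringClaims) (Θ : D.PiC ≃* D'.PiC)
    (hΘ : D.piXarrow.map Θ.toMonoidHom = D'.piXarrow) :
    D.piCarrow.map Θ.toMonoidHom = D'.piCarrow := by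
  have hC := hR.map_piCbar_eq hR' Θ hΘ
  obtain ⟨Φ, hΦ⟩ := exists_restrict_piCbar Θ hC
  have hX := map_subgroupOf_piXarrow_of_restrict Θ Φ hΦ hΘ
  have hl := h.l_eq_of_map_subgroupOf_piXarrow_eq h' Φ hX
  have key := h.map_subgroupOf_piCarrow_eq h' Φ hX hl
  rw [Subgroup.map_subgroupOf_eq_of_restrict Θ Φ hΦ D.piCarrow_le_piCbar, Subgroup.subgroupOf_inj,
    inf_eq_left.mpr D'.piCarrow_le_piCbar] at key
  rw [← key, eq_comm, inf_eq_left, ← hC]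
  exact Subgroup.map_mono D.piCarrow_le_piCbar

/-! ### Corollary 1.2 from its two anabelian inputs -/

/-- An isomorphism `Φ : Π_C̲ ⥲ Π'_C̲` EXTENDING an isomorphism `φ : Π_{X→} ⥲ Π'_{X→}` carries
`Π_{X→} ⊆ Π_C̲` onto `Π'_{X→} ⊆ Π'_C̲`. ([IUTchI] Cor 1.2 p.39) [claim: Mochizuki2012, status: disputed] -/
theorem map_subgroupOf_piXarrow_eq_of_extends (φ : D.piXarrow ≃* D'.piXarrow)
    (Φ : D.PiCbar ≃* D'.PiCbar)
    (hext : ∀ (x : D.PiC) (hx : x ∈ D.piXarrow) (hx' : x ∈ D.PiCbar),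
      (Φ ⟨x, hx'⟩ : D'.PiC) = (φ ⟨x, hx⟩ : D'.PiC)) :
    (D.piXarrow.subgroupOf D.PiCbar).map Φ.toMonoidHom = D'.piXarrow.subgroupOf D'.PiCbar := by
  ext y
  simp only [Subgroup.mem_map, Subgroup.mem_subgroupOf, MulEquiv.coe_toMonoidHom]
  constructor
  · rintro ⟨x, hx, rfl⟩
    have hx' := hext (x : D.PiC) hx x.2
    rw [Subtype.coe_eta] at hx'
    rw [hx']
    exact (φ ⟨x, hx⟩).2
  · intro hy
    set x : D.piXarrow := φ.symm ⟨(y : D'.PiC), hy⟩ with hxdef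
    refine ⟨⟨(x : D.PiC), D.piXarrow_le_piCbar x.2⟩, x.2, ?_⟩
    apply Subtype.ext
    rw [hext (x : D.PiC) x.2 (D.piXarrow_le_piCbar x.2), Subtype.coe_eta, hxdef,
      MulEquiv.apply_symm_apply]

/-- **Corollary 1.2 (Characteristic Nature of Coverings) from its anabelian inputs.**  For data
`D`, `D'` satisfying the printed claims of pp. 37–38 (`ArrowCoveringClaims`), the typed Corollary
1.2 holds AS SOON AS the two anabelian steps of the printed proof (p. 39) are supplied — stated here
as hypotheses, never asserted: (`hX`) every bicontinuous `φ : Π_{X→} ⥲ Π'_{X→}` extends to a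
continuous `Φ : Π_C̲ ⥲ Π'_C̲` respecting the conjugacy classes of the decomposition groups of
`{ε′, ε″}` and of `ε̲` ["`C` is a `k`-core" + [AbsTopI] Lem. 4.5 / [AbsAnab] Lem. 1.3.9 as amended
by Rmk. 1.2.2 — prerequisite-layer facts, seat abc-iut-L4-t4]; (`hC`) likewise for `Π_{C→}`.  The
remaining clauses `Φ(Π_X̲) = Π'_X̲`, `Φ(Π_{C→}) = Π'_{C→}` are the group theory proved above.
([IUTchI] Cor 1.2 p.39) [claim: Mochizuki2012, status: disputed] -/
theorem characteristicNatureOfCoverings_of_core_extensions (h : D.ArrowCoveringClaims)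
    (h' : D'.ArrowCoveringClaims)
    (hX : ∀ φ : D.piXarrow ≃* D'.piXarrow, Continuous φ → Continuous φ.symm →
      ∃ Φ : D.PiCbar ≃* D'.PiCbar, Continuous Φ ∧
        (∀ (x : D.PiC) (hx : x ∈ D.piXarrow) (hx' : x ∈ D.PiCbar),
          (Φ ⟨x, hx'⟩ : D'.PiC) = (φ ⟨x, hx⟩ : D'.PiC)) ∧
        Subgroup.map Φ.toMonoidHom '' D.cuspClassX = D'.cuspClassX ∧
        Subgroup.map Φ.toMonoidHom '' D.cuspClassC = D'.cuspClassC)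
    (hC : ∀ ψ : D.piCarrow ≃* D'.piCarrow, Continuous ψ → Continuous ψ.symm →
      ∃ Ψ : D.PiCbar ≃* D'.PiCbar, Continuous Ψ ∧
        (∀ (x : D.PiC) (hx : x ∈ D.piCarrow) (hx' : x ∈ D.PiCbar),
          (Ψ ⟨x, hx'⟩ : D'.PiC) = (ψ ⟨x, hx⟩ : D'.PiC)) ∧
        Subgroup.map Ψ.toMonoidHom '' D.cuspClassC = D'.cuspClassC) :
    D.CharacteristicNatureOfCoverings D' := by
  refine ⟨fun φ hφ hφ' => ?_, fun ψ hψ hψ' => hC ψ hψ hψ'⟩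
  obtain ⟨Φ, hΦc, hext, hcuspX, hcuspC⟩ := hX φ hφ hφ'
  have hA := map_subgroupOf_piXarrow_eq_of_extends φ Φ hext
  have hl := h.l_eq_of_map_subgroupOf_piXarrow_eq h' Φ hA
  exact ⟨Φ, hΦc, hext, h.map_subgroupOf_piXbar_eq h' Φ hA, h.map_subgroupOf_piCarrow_eq h' Φ hA hl,
    hcuspX, hcuspC⟩

end PuncturedEllipticData

end Literature.IUT.HodgeTheaters
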